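import Summits.ABC.ABC.Theorems.IsogenyGlueCongruencePolyAbcOfPolyDegree
import HarnessLib

/-!
# Route IsogenyGlueCongruence — support `PolyAbcOfPolyDegree` (stmt-ABC-2048): the exact residual

`Summit.ABC.ABC.Theses.IsogenyGlueCongruence.PolyAbcOfPolyDegree` asks: a polynomial modular-degree
bound `deg φ ≤ C · N^κ` for the SEMISTABLE elliptic curves over `ℚ` in global minimal form implies
`Literature.Barriers.ABC.BakerShapeBound 0 1` (`∃ κ', log c ≤ κ' · log rad(abc)` for ALL abc triples).

`Summit.ABC.ABC.Theorems.polyAbcSixteen_of_polyDegree` (tree) proves the conclusion from the filed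
antecedent for the abc triples with `16 ∣ abc` (their arranged Frey curve is semistable). This file
records, kernel-checked, that NOTHING ELSE is missing and nothing less suffices: the item is
EQUIVALENT to the residual implication

  (filed antecedent) → ∃ κ, ∀ abc triples with `¬ 16 ∣ abc`, `log c ≤ κ · log rad(abc)`,

i.e. to polynomial abc on the `2`-adically bounded triples (`v₂(abc) ≤ 3`, whose Frey curves
`y² = x(x − a)(x + b)` have additive, potentially good reduction at `2`: `v₂(j) = 8 − 2·v₂(abc) ≥ 2`,
so no quadratic twist is semistable) from a hypothesis that only speaks about semistable curves.
No transfer between the two `2`-adic regions is known over `ℚ`: a rational map `P¹ → P¹` of degree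
`n` with `β⁻¹{0, 1, ∞} ⊆ {0, 1, ∞}` has `n = 1` (Riemann–Hurwitz: `#β⁻¹{0,1,∞} = n + 2`), so every
identity-based normalisation of degree `n ≥ 2` enlarges the radical by a factor up to `c^{n−1}`
(e.g. `(u⁴, v⁴ − u⁴, v⁴)`: informative only for abc exponents `< 4/3`; the route's
`(u⁸, v⁸ − u⁸, v⁸)`: `< 8/7`), while the exponent produced by the antecedent is a free `κ`.
Lands `--supports stmt-ABC-2048`; the planner's restatement options are in the item's notes.
-/

open Literature.NumberTheory.EllipticCurves.ModularForms (ModularParametrizationData)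
open Literature.NumberTheory.DiophantineGeometry (IsABCTriple rad)
open Literature.Barriers.ABC (BakerShapeBound)

-- `Summit.<Summit>.<Problem>` is the mandated summit-side namespace (CONVENTIONS §2); for the
-- single-conjunct summit `ABC` the two coincide, so the duplicate `ABC.ABC` is deliberate.
set_option linter.dupNamespace false

namespace Summit.ABC.ABC.Theorems

/-- **The exact residual of `PolyAbcOfPolyDegree`.** The filed item (polynomial modular degree for
semistable curves ⟹ `BakerShapeBound 0 1`) is equivalent to: the same antecedent implies
polynomial abc, `∃ κ, log c ≤ κ · log rad(abc)`, on the abc triples with `¬ 16 ∣ abc`.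
(`→`: specialise `BakerShapeBound 0 1`, `rad⁰ = 1`; `←`: glue with
`polyAbcSixteen_of_polyDegree` on the triples with `16 ∣ abc`, taking the larger of the two
constants, `log rad ≥ 0`.) [folklore] -/
theorem polyAbcOfPolyDegree_iff_residual :
    Summit.ABC.ABC.Theses.IsogenyGlueCongruence.PolyAbcOfPolyDegree ↔
      ((∃ κ C : ℝ, ∀ (W : WeierstrassCurve ℚ) [W.IsElliptic] [W.IsGloballyMinimal]
          [NeZero (W.conductorNorm ℤ)], W.IsSemistable ℤ →
            ∃ D : ModularParametrizationData W (W.conductorNorm ℤ),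
              (D.modularDegree : ℝ) ≤ C * (W.conductorNorm ℤ : ℝ) ^ κ) →
        ∃ κ : ℝ, ∀ a b c : ℕ, IsABCTriple a b c → ¬ 16 ∣ a * b * c →
          Real.log c ≤ κ * Real.log (rad a b c : ℕ)) := by
  constructor
  · intro h hdeg
    obtain ⟨κ, hκ⟩ := h hdeg
    refine ⟨κ, fun a b c habc _ ↦ ?_⟩
    simpa only [Real.rpow_zero, mul_one, pow_one] using hκ a b c habc
  · intro hres hdeg
    obtain ⟨κ₁, h₁⟩ := hres hdeg
    obtain ⟨κ₂, h₂⟩ := polyAbcSixteen_of_polyDegree hdeg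
    refine PolyAbc.bakerShapeBound_zero_one_of_log ⟨max κ₁ κ₂, fun a b c habc ↦ ?_⟩
    have hlog : 0 ≤ Real.log (rad a b c : ℕ) := Real.log_natCast_nonneg _
    by_cases h16 : 16 ∣ a * b * c
    · exact (h₂ a b c habc h16).trans (mul_le_mul_of_nonneg_right (le_max_right _ _) hlog)
    · exact (h₁ a b c habc h16).trans (mul_le_mul_of_nonneg_right (le_max_left _ _) hlog)

/-- **One-sided form (the fourth restatement option).** Polynomial abc on the abc triples with
`¬ 16 ∣ abc`, from the semistable polynomial modular-degree hypothesis, already gives the filed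
item. [folklore] -/
theorem polyAbcOfPolyDegree_of_residual
    (hres : (∃ κ C : ℝ, ∀ (W : WeierstrassCurve ℚ) [W.IsElliptic] [W.IsGloballyMinimal]
        [NeZero (W.conductorNorm ℤ)], W.IsSemistable ℤ →
          ∃ D : ModularParametrizationData W (W.conductorNorm ℤ),
            (D.modularDegree : ℝ) ≤ C * (W.conductorNorm ℤ : ℝ) ^ κ) →
      ∃ κ : ℝ, ∀ a b c : ℕ, IsABCTriple a b c → ¬ 16 ∣ a * b * c →
        Real.log c ≤ κ * Real.log (rad a b c : ℕ)) :
    Summit.ABC.ABC.Theses.IsogenyGlueCongruence.PolyAbcOfPolyDegree :=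
  polyAbcOfPolyDegree_iff_residual.2 hres

end Summit.ABC.ABC.Theorems
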